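import Mathlib.Topology.MetricSpace.Closeds
import Literature.Barriers.CriticalPhenomena.SupercriticalSAWSpaceFillingMesoscopic
import Literature.Probability.RandomPlanarGeometry.SeparatedTraces
import HarnessLib

/-!
# Barrier mechanism, thirteenth audit: the TOPOLOGY axis — the obstruction needs only
# convergence of the TRACE as a random compact set (Hausdorff = Vietoris hyperspace), and in
# that topology the supercritical scaling limit exists and is the point mass at `𝔻̄`

Barrier catalogue `Literature/Barriers/CriticalPhenomena/` (D-0021); thirteenth audit
(2026-08-16, refuter, "barrier-audit" gen 13) of the mechanism file `…Proofs` of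
`SupercriticalSAWSpaceFilling` (= Theorem 1 of H. Duminil-Copin, G. Kozma, A. Yadin,
*Supercritical self-avoiding walks are space-filling*, Ann. IHP Probab. Stat. 50 (2014) 315–326,
arXiv:1110.3074 — PROVED in the tree, `SupercriticalSAWSpaceFilling_holds`; `blocks:` line
`¬ RobustSAWScalingLimit` proved with no hypothesis, `SupercriticalSAW.not_robustSAWScalingLimit`;
axiom closures of both and of `SupercriticalSAW.sawScalingLimitAt_iff_of_pos` re-checked in this
audit: `propext`, `Classical.choice`, `Quot.sound`).

Generations 1–12 treated the FUGACITY axis (both sides of `x_c`, windows, tuned / annealed /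
complex fugacities), the CONCLUSION axis (trace versus prefix, onto-compatible conclusions,
reversibility, the `(x, κ)` phase constraint, side observables), the LENGTH, DENSITY, ENSEMBLE
and SCALE axes. All their theorems about scaling limits are stated in the CURVE topology
(`Literature.Probability.RandomPlanarGeometry.TendstoLaw` on `CurveClass ℂ`, the metric `d` of
Lawler–Schramm–Werner §3.4.1); the second audit asserted in prose that the weaker Hausdorff
metric `d_H ≤ d` on traces is "obstructed as well", without a declaration. Meanwhile routes of
this summit DO work in the hyperspace: laws of `range γ_δ` on the compact set `{K ⊆ D̄}` of
`NonemptyCompacts ℂ` are relatively compact with no tightness estimate, and a limit can be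
identified through avoidance functionals (the uniqueness theorem
`Literature.MeasureTheory.RandomSets.ext_of_forall_measure_setOf_disjoint_eq`). This audit asks
what Theorem 1 says in that topology.

Outcome: **CONFIRMED at page level and STRENGTHENED on the topology axis — (a) the one-sided
portmanteau mechanism holds verbatim for random compact SETS: whatever the traces of a weakly
space-filling family converge to in law, in the hyperspace `NonemptyCompacts` (Hausdorff metric
topology, which on the compact subsets of a fixed compact set coincides with the Vietoris /
myopic and Fell topologies of random-set theory, where laws of random closed sets and their
avoidance functionals live), almost surely contains the closed domain
(`ae_closure_subset_of_tendstoLaw_sets`),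
and the curve-topology mechanism of `…Proofs`/`…ProofsNarrow` is its pull-back under the
continuous trace map (`ae_subset_range_of_tendstoLaw'`); (b) in that topology the supercritical
scaling limit EXISTS and is trivial: for every `x > x_c` the trace of the walk of `(𝔻; a, b)`
converges in probability, in the Hausdorff metric, to `𝔻̄`
(`tendsto_lawAt_lt_hausdorffDist_closedDisk`), i.e. in law to `δ_{𝔻̄}`
(`tendstoLaw_traceNC_closedDisk_supercritical`), and conversely this convergence IS the printed
weak space-filling property (`isSpaceFillingFamily_of_tendsto_hausdorffDist`).** No new
unobstructed class was found (no card seed); one scope remark is added (interior endpoints).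

## What the audit found

1. **Hyperspace portmanteau (proved).** For random compact sets `X δ → Z` in law (bounded
   continuous test functions on `NonemptyCompacts E`, finite measures) and an open `Ω` all of
   whose balls are missed by `X δ` with probability `→ 0`, `W`-a.s. `closure Ω ⊆ Z`
   (`ae_subset_of_tendstoLaw_sets`, `ae_closure_subset_of_tendstoLaw_sets`): the functional
   `K ↦ g_r(dist(z, K))` (`setMissFunctional`) is `1/r`-Lipschitz for `d_H`
   (`Metric.lipschitz_infDist_set`), its lattice integrals are dominated by the miss
   probabilities (`integral_setMissFunctional_comp_le`) and its limit integral dominates the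
   probability of missing `B(z, 2r)` (`measureReal_le_integral_setMissFunctional`). Hence no
   hyperspace limit of such a family has a non-trivial avoidance functional on `Ω`
   (`not_tendstoLaw_sets_of_not_ae_subset`, `not_ae_subset_of_measure_ne_zero_sets`). Since the
   trace map `CurveClass E → NonemptyCompacts E` is `1`-Lipschitz (`lipschitzWith_traceNC`,
   from `CurveClass.hausdorffDist_range_le_dist`), convergence in law of curves implies that of
   traces (`tendstoLaw_traceNC_of_tendstoLaw`) and the curve statement of `…ProofsNarrow` is a
   corollary (`ae_subset_range_of_tendstoLaw'`): the topology axis only ENLARGES the obstructed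
   class.
2. **The hyperspace limit is deterministic (proved).** If the `X δ` lie in `closure Ω`, `closure Ω`
   is compact, and every ball of `Ω` is missed with probability `→ 0`, then
   `P δ[d_H(X δ, closure Ω) > r] → 0` for every `r > 0`
   (`tendsto_measure_lt_hausdorffDist_of_forall_ball`: a finite subcover of `closure Ω` by balls
   `B(zᵢ, r/2)`, `zᵢ ∈ Ω`, shrunk into `Ω`); convergence in probability to a constant is
   convergence in law to the point mass (`tendstoLaw_const_of_tendsto_measure_lt_dist`). For the
   fugacity-`x` walk of the unit disc, `x > x_c`, closest-site endpoints of boundary points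
   `a ≠ b` (Theorem 1, `DKY2014_thm1_holds`; traces inside `𝔻` by convexity,
   `range_curve_subset_unitDisk`): `tendsto_lawAt_lt_hausdorffDist_closedDisk`,
   `tendstoLaw_traceNC_closedDisk_supercritical` (limit `δ_{𝔻̄}` in `NonemptyCompacts ℂ`),
   `ae_closedDisk_subset_of_tendstoLaw_sets_supercritical`, `not_tendstoLaw_sets_supercritical`.
   Conversely Hausdorff convergence in probability to `𝔻̄` implies the weak space-filling of §1
   for any laws (`isSpaceFillingFamily_of_tendsto_hausdorffDist`): at the lattice level the
   printed property ("for any open set `U ⊂ Ω`, `P[γ_δ ∩ U = ∅] → 0`", p. 2) is EQUIVALENT to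
   "the trace converges in probability to `Ω̄` in the Hausdorff metric".
3. **Consequences for the technique class.** Every fugacity-robust (right-closed or two-sided)
   conclusion identifying or constraining the hyperspace scaling limit of the trace by anything
   but `δ_{𝔻̄}` — convergence to the trace of chordal SLE_κ (`κ < 8`), to conformal-restriction
   hulls, to a random set of dimension `< 2`, positivity of a limiting avoidance / capacity
   functional on some open subset of the domain — fails at every `x > x_c`. There is no
   topological refuge on the trace within the standard theory of random closed sets: on the
   compact subsets of `𝔻̄` the Hausdorff metric topology IS the Vietoris (myopic) = Fell topology
   (Molchanov 2005, App. C), in which the miss events of open balls are closed (in the tree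
   `Literature.MeasureTheory.RandomSets.isClosed_setOf_disjoint`, here re-proved metrically as
   `isClosed_setOf_disjoint_ball`); coarser, non-Hausdorff hyperspace topologies (lower Vietoris)
   are not a setting in which scaling limits are formulated. And the hyperspace carries NO
   information on the
   supercritical phase beyond Theorem 1: the SLE₈ structure predicted by Conjecture 11 (p. 8) is
   invisible to it (the trace of SLE₈ in `D` is `D̄` as well). A hyperspace route to the
   sub-problem (compactness of `{K ⊆ D̄}` + identification by avoidance functionals) is therefore
   admissible exactly like a curve-topology route: AT `x_c` or in the fugacity-free classes, with
   an `x_c`-specific identification input; run at any `x > x_c` the same compactness argument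
   converges, to `δ_{𝔻̄}`.
4. **Scope remark (endpoint axis), no declaration.** Theorems 1 and 2 of the source are printed
   for "two points on its boundary" (pp. 2–3) and the tree's Peierls estimate
   (`SupercriticalSAW.DKY2014_thm6_disk`, `…TilesTheorem6`) is organised around closest sites of
   two distinct boundary points (an annular sum for walks avoiding all deep tiles); radial
   (boundary-to-interior) and interior-to-interior variants are covered by no declaration,
   although the local surgery of Proposition 7 (p. 6) does not see the endpoints, so `x`-robust
   conclusions for those variants are dead in substance. Recorded in `scope_caveats`.
5. **Examined and reduced (no declaration).** Conclusions about RATIOS of partition functions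
   with different marked points in one domain (`Z_δ(a→b; x)/Z_δ(a→c; x) →` a conformally
   covariant boundary two-point ratio with exponent `5/8`) involve no avoidance event and are
   untouched by Theorem 1 at every `x`; their failure above `x_c` rests on the (non-rigorous)
   dense-polymer boundary exponents, so they belong with the side observables (xiii) of the base
   entry: right-robust versions certified false at no `x > x_c` by the source or the tree,
   two-sided versions dead on the subcritical geodesic picture; SCALE covariance of `Z_δ`
   (`Z_δ(λD)/Z_δ(D) → λ^{-5/4}`) is instead obstructed in substance by the extensive supercritical
   free energy (the density axis (xiv), `…Density`).
6. **Confirmed (page level, arXiv text re-read in this audit).** p. 2: the weak sense of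
   space-filling, "It should be the Schramm-Löwner Evolution of parameter 8", Theorem 1 verbatim;
   p. 3: Theorem 2 ("Let `(Ω,a,b)` be a bounded domain with two points on the boundary"), all
   dimensions, the hexagonal lattice; p. 8: "We know that the curve becomes space-filling, yet we
   have very little additional information", "It is not difficult to show that the length is of
   order `1/δ²`", Problems 9–10, Conjecture 11. Forward literature (citations of the source since
   2023: 4, newest Krachun–Panagiotis, Ann. Probab. 54 (2026); zbMATH "self-avoiding walk"
   2025–2026: 38 items; Crossref; the internal galaxy corpora): nothing on supercritical planar
   scaling limits, on Problem 10, or contradicting Theorem 1; the hub's local full-text index,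
   OpenAlex and Semantic Scholar were unavailable or rate-limited during this audit.

## Formal content (all proved; one new closed `Prop`, `SupercriticalSAWSpaceFillingHyperspace`)

`SupercriticalSAW.setMissFunctional` (+ `_apply`, `_nonneg`, `_le_one`, `_eq_one`, `_eq_zero`,
`infDist_le_of_setMissFunctional_eq_zero`), `setOf_disjoint_ball_eq`,
`isClosed_setOf_disjoint_ball`, `measurableSet_setOf_disjoint_ball`; the trace map `traceNC`
(`coe_traceNC`, `lipschitzWith_traceNC`, `continuous_traceNC`, `setMissFunctional_traceNC`);
hyperspace portmanteau `integral_setMissFunctional_comp_le`,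
`measureReal_le_integral_setMissFunctional`, `ae_infDist_le_of_tendstoLaw_sets`,
`ae_subset_of_tendstoLaw_sets`, `ae_closure_subset_of_tendstoLaw_sets`,
`not_tendstoLaw_sets_of_not_ae_subset`, `not_ae_subset_of_measure_ne_zero_sets`,
`tendstoLaw_traceNC_of_tendstoLaw`, `ae_subset_range_of_tendstoLaw'`; deterministic limits
`tendsto_measure_lt_hausdorffDist_of_forall_ball`, `tendstoLaw_const_of_tendsto_measure_lt_dist`;
SAW laws `range_toCurve_subset_of_convex`, `range_curve_subset_unitDisk`, `isOpen_unitDisk`,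
`closure_unitDisk`, `IsSpaceFillingLaws.tendsto_measure_disjoint_ball_traceNC`,
`IsSpaceFillingLaws.ae_closure_subset_of_tendstoLaw_sets`, `IsSpaceFillingLaws.not_tendstoLaw_sets`;
the supercritical disc `tendsto_lawAt_lt_hausdorffDist_closedDisk`,
`isSpaceFillingFamily_of_tendsto_hausdorffDist`,
`ae_closedDisk_subset_of_tendstoLaw_sets_supercritical`, `not_tendstoLaw_sets_supercritical`,
`tendstoLaw_traceNC_closedDisk_supercritical`; the closed `Prop`
`SupercriticalSAWSpaceFillingHyperspace`, `SupercriticalSAWSpaceFillingHyperspace_holds`,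
`SupercriticalSAWSpaceFillingHyperspace.isSpaceFillingFamily`. Measurability on the hyperspace is
taken as instance parameters `[MeasurableSpace (NonemptyCompacts E)] [OpensMeasurableSpace _]`
(`[BorelSpace _]` for the curve corollary), as in `Literature.MeasureTheory.RandomSets`.

Mathlib: `Metric.NonemptyCompacts.instMetricSpace`, `Metric.NonemptyCompacts.dist_eq`,
`Metric.lipschitz_infDist_set`, `Metric.hausdorffDist_le_of_infDist`,
`Metric.exists_dist_lt_of_hausdorffDist_lt'`, `Metric.hausdorffEDist_ne_top_of_nonempty_of_bounded`,
`IsCompact.elim_finite_subcover_image`, `measure_biUnion_finset_le`, `tendsto_finsetSum`,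
`MeasureTheory.measure_toMeasurable`, `MeasureTheory.abs_integral_le_integral_abs`,
`BoundedContinuousFunction.compContinuous`, `BoundedContinuousFunction.norm_coe_le_norm`,
`Metric.continuous_iff`, `gt_mem_nhds`, `ENNReal.toReal_lt_of_lt_ofReal`, `closure_ball`,
`Convex.segment_subset`, `integral_eq_zero_iff_of_nonneg_ae`, `ae_all_iff`.

## References (page-level, audit 2026-08-16; pages of the arXiv versions)

* H. Duminil-Copin, G. Kozma, A. Yadin, Ann. IHP Probab. Stat. 50 (2014) 315–326,
  arXiv:1110.3074: p. 2 (§1: weak sense of space-filling; SLE₈ prediction; Theorem 1), p. 3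
  (Theorem 2, "two points on the boundary"; all dimensions; hexagonal lattice), p. 6
  (Proposition 7), p. 8 (§4: "very little additional information"; "the length is of order
  `1/δ²`"; Problems 9–10; Conjecture 11). [DuminilCopinKozmaYadin2014]
* G. F. Lawler, O. Schramm, W. Werner, *On the scaling limit of planar self-avoiding walk*,
  Proc. Sympos. Pure Math. 72.2 (2004), arXiv:math/0204277: pp. 12–13, §3.4.1 (the metrics
  `d_H ≤ d`; "proofs of convergence using the weaker metric `d_H` would be interesting").
  [LawlerSchrammWerner2004SAW]
* I. Molchanov, *Theory of Random Sets*, Springer (2005): Chap. 1, §1.6 (avoidance functional),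
  App. C (myopic = Hausdorff topology on compact sets; miss events). [Molchanov2005]
* P. Billingsley, *Convergence of probability measures*, 2nd ed. (1999), Thm 2.1 (portmanteau).
  [Billingsley1999]
* D. Krachun, C. Panagiotis, *Quantitative sub-ballisticity of self-avoiding walk on the
  hexagonal lattice*, Ann. Probab. 54 (2026) 1109–1125, arXiv:2310.17299 (newest forward
  citation; critical phase at the exact `x_c`). [KrachunPanagiotis2026]
-/

noncomputable section

open MeasureTheory Filter Topology Metric Set TopologicalSpace
  Literature.Probability.LatticeModels Literature.Probability.Percolation
  Literature.Probability.RandomPlanarGeometry Literature.Probability.RandomPlanarGeometry.SAW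
open scoped ENNReal NNReal BoundedContinuousFunction

namespace Literature.Barriers.CriticalPhenomena

namespace SupercriticalSAW

/-! ### The miss functional on the hyperspace of nonempty compact sets -/

section SetFunctional

variable {E : Type*} [MetricSpace E]

/-- **The hyperspace test functional** `F_{z,r}(K) = g_r(dist(z, K))` on nonempty compact sets
(`g_r` = `missProfile r`): bounded by `1`, continuous for the Hausdorff metric because
`K ↦ dist(z, K)` is `1`-Lipschitz (`Metric.lipschitz_infDist_set`); `F = 1` on sets missing the
ball `B(z, 2r)`, `F = 0` on sets meeting the open ball `B(z, r)`. [folklore] -/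
def setMissFunctional (z : E) (r : ℝ) : NonemptyCompacts E →ᵇ ℝ :=
  BoundedContinuousFunction.mkOfBound
    ⟨fun K => missProfile r (infDist z (K : Set E)),
      (continuous_missProfile r).comp (Metric.lipschitz_infDist_set z).continuous⟩
    1 fun K₁ K₂ => by
      simp only [ContinuousMap.coe_mk, Real.dist_eq]
      have h₁ := missProfile_nonneg r (infDist z (K₁ : Set E))
      have h₂ := missProfile_le_one r (infDist z (K₁ : Set E))
      have h₃ := missProfile_nonneg r (infDist z (K₂ : Set E))
      have h₄ := missProfile_le_one r (infDist z (K₂ : Set E))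
      rw [abs_le]
      constructor <;> linarith

/-- Value of the hyperspace test functional. [folklore] -/
theorem setMissFunctional_apply (z : E) (r : ℝ) (K : NonemptyCompacts E) :
    setMissFunctional z r K = missProfile r (infDist z (K : Set E)) := rfl

/-- `0 ≤ F`. [folklore] -/
theorem setMissFunctional_nonneg (z : E) (r : ℝ) (K : NonemptyCompacts E) :
    0 ≤ setMissFunctional z r K :=
  missProfile_nonneg _ _

/-- `F ≤ 1`. [folklore] -/
theorem setMissFunctional_le_one (z : E) (r : ℝ) (K : NonemptyCompacts E) :
    setMissFunctional z r K ≤ 1 :=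
  missProfile_le_one _ _

/-- A compact set missing the ball `B(z, 2r)` has `F = 1`. [folklore] -/
theorem setMissFunctional_eq_one {z : E} {r : ℝ} (hr : 0 < r) {K : NonemptyCompacts E}
    (h : Disjoint (ball z (2 * r)) (K : Set E)) : setMissFunctional z r K = 1 := by
  rw [setMissFunctional_apply]
  refine missProfile_eq_one hr ((le_infDist K.nonempty).2 fun y hy => ?_)
  by_contra hlt
  exact (Set.disjoint_left.1 h (mem_ball'.2 (not_le.1 hlt))) hy

/-- A compact set with a point at distance `< r` from `z` has `F = 0`. [folklore] -/
theorem setMissFunctional_eq_zero {z : E} {r : ℝ} (hr : 0 < r) {K : NonemptyCompacts E} {y : E}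
    (hy : y ∈ (K : Set E)) (hyz : dist y z < r) : setMissFunctional z r K = 0 := by
  rw [setMissFunctional_apply]
  refine missProfile_eq_zero hr ?_
  rw [dist_comm] at hyz
  exact (infDist_le_dist_of_mem hy).trans hyz.le

/-- `F(K) = 0` forces `dist(z, K) ≤ r`. [folklore] -/
theorem infDist_le_of_setMissFunctional_eq_zero {z : E} {r : ℝ} (hr : 0 < r)
    {K : NonemptyCompacts E} (h : setMissFunctional z r K = 0) : infDist z (K : Set E) ≤ r :=
  le_of_missProfile_eq_zero hr h

/-- The miss event of an open ball in the hyperspace is the superlevel set `{dist(z, ·) ≥ r}`.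
[folklore] -/
theorem setOf_disjoint_ball_eq (z : E) (r : ℝ) :
    {K : NonemptyCompacts E | Disjoint (ball z r) (K : Set E)} =
      (fun K : NonemptyCompacts E => infDist z (K : Set E)) ⁻¹' Ici r := by
  ext K
  simp only [mem_setOf_eq, mem_preimage, mem_Ici]
  rw [le_infDist K.nonempty]
  constructor
  · intro h y hy
    by_contra hlt
    exact (Set.disjoint_left.1 h (mem_ball'.2 (not_le.1 hlt))) hy
  · intro h
    exact Set.disjoint_left.2 fun y hyb hyK => (not_lt.2 (h hyK)) (mem_ball'.1 hyb)

/-- **Miss events of open balls are closed in the hyperspace** (Hausdorff = Vietoris = Fell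
topology on compact sets; Molchanov 2005, App. C). [folklore] -/
theorem isClosed_setOf_disjoint_ball (z : E) (r : ℝ) :
    IsClosed {K : NonemptyCompacts E | Disjoint (ball z r) (K : Set E)} := by
  rw [setOf_disjoint_ball_eq]
  exact isClosed_Ici.preimage (Metric.lipschitz_infDist_set z).continuous

/-- Hence miss events of open balls are Borel. [folklore] -/
theorem measurableSet_setOf_disjoint_ball [MeasurableSpace (NonemptyCompacts E)]
    [OpensMeasurableSpace (NonemptyCompacts E)] (z : E) (r : ℝ) :
    MeasurableSet {K : NonemptyCompacts E | Disjoint (ball z r) (K : Set E)} :=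
  (isClosed_setOf_disjoint_ball z r).measurableSet

end SetFunctional

/-! ### The trace map from curve classes to the hyperspace -/

section TraceMap

variable {E : Type*} [MetricSpace E]

/-- The trace of an unparametrised curve as a point of the hyperspace `NonemptyCompacts E`.
[folklore] -/
def traceNC (c : CurveClass E) : NonemptyCompacts E :=
  ⟨⟨c.range, c.isCompact_range⟩, c.range_nonempty⟩

/-- The carrier of `traceNC c` is the trace. [folklore] -/
@[simp] theorem coe_traceNC (c : CurveClass E) : (traceNC c : Set E) = c.range := rfl

/-- **The trace map is `1`-Lipschitz** from the curve metric `d` to the Hausdorff metric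
`d_H ≤ d` (Lawler–Schramm–Werner 2004, §3.4.1; `CurveClass.hausdorffDist_range_le_dist`).
[cite: LawlerSchrammWerner2004SAW, §3.4.1] -/
theorem lipschitzWith_traceNC : LipschitzWith 1 (traceNC : CurveClass E → NonemptyCompacts E) :=
  LipschitzWith.mk_one fun c c' => by
    rw [NonemptyCompacts.dist_eq]
    exact CurveClass.hausdorffDist_range_le_dist c c'

/-- The trace map is continuous. [folklore] -/
theorem continuous_traceNC : Continuous (traceNC : CurveClass E → NonemptyCompacts E) :=
  lipschitzWith_traceNC.continuous

/-- The hyperspace functional of the trace is the curve functional of `…Proofs`. [folklore] -/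
theorem setMissFunctional_traceNC (z : E) (r : ℝ) (c : CurveClass E) :
    setMissFunctional z r (traceNC c) = missFunctional z r c := rfl

end TraceMap

/-! ### One-sided portmanteau in the hyperspace -/

section Hyperspace

variable {E : Type*} [MetricSpace E]
  {Ωδ : ℝ → Type*} [∀ δ, MeasurableSpace (Ωδ δ)] {P : ∀ δ, Measure (Ωδ δ)}
  {Ω' : Type*} [MeasurableSpace Ω'] {W : Measure Ω'}

/-- A random compact set missing a ball `B(z, 2r)`, `B(z, r) ⊆ Ω`, with positive `W`-measure —
a random set with a non-trivial AVOIDANCE FUNCTIONAL on `Ω` — is not almost surely a superset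
of `Ω`. [folklore] -/
theorem not_ae_subset_of_measure_ne_zero_sets {Z : Ω' → NonemptyCompacts E} {Ω : Set E} {z : E}
    {r : ℝ} (hr : 0 < r) (hball : ball z r ⊆ Ω)
    (hpos : W {ω | Disjoint (ball z (2 * r)) (Z ω : Set E)} ≠ 0) :
    ¬ ∀ᵐ ω ∂W, Ω ⊆ (Z ω : Set E) := by
  intro h
  apply hpos
  rw [measure_eq_zero_iff_ae_notMem]
  filter_upwards [h] with ω hω hdis
  have hz : z ∈ (Z ω : Set E) := hω (hball (mem_ball_self hr))
  exact Set.disjoint_left.1 hdis (mem_ball_self (by linarith)) hz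

/-- **The curve topology is a special case.** Convergence in law of random curve classes (metric
`d`) implies convergence in law of their traces as random compact sets (metric `d_H ≤ d`): the
trace map is continuous, so bounded continuous hyperspace functionals pull back to bounded
continuous curve functionals. Hence every hyperspace obstruction is a curve-topology
obstruction, and the core lemma of `…Proofs` / `…ProofsNarrow` is the pull-back of
`ae_subset_of_tendstoLaw_sets` below. [cite: LawlerSchrammWerner2004SAW, §3.4.1] -/
theorem tendstoLaw_traceNC_of_tendstoLaw {Y : ∀ δ, Ωδ δ → CurveClass E} {Γ : Ω' → CurveClass E}
    (hT : TendstoLaw Y P Γ W) :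
    TendstoLaw (fun δ ω => traceNC (Y δ ω)) P (fun ω => traceNC (Γ ω)) W :=
  fun f => hT (f.compContinuous ⟨traceNC, continuous_traceNC⟩)

variable [MeasurableSpace (NonemptyCompacts E)] [OpensMeasurableSpace (NonemptyCompacts E)]

/-- **Lattice side**: for a finite measure `μ` and a measurable random compact set `X`,
`∫ F_{z,r}(X) dμ ≤ μ[X ∩ B(z, r) = ∅]` (`F_{z,r} ≤ 1` vanishes when `X` meets `B(z, r)`).
[folklore] -/
theorem integral_setMissFunctional_comp_le {α : Type*} [MeasurableSpace α] (μ : Measure α)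
    [IsFiniteMeasure μ] {X : α → NonemptyCompacts E} (hX : Measurable X) {z : E} {r : ℝ}
    (hr : 0 < r) :
    ∫ ω, setMissFunctional z r (X ω) ∂μ ≤
      (μ {ω | Disjoint (ball z r) (X ω : Set E)}).toReal := by
  set S : Set α := {ω | Disjoint (ball z r) (X ω : Set E)}
  have hS : MeasurableSet S := hX (measurableSet_setOf_disjoint_ball z r)
  rw [← measureReal_def, ← integral_indicator_one hS]
  refine integral_mono ?_ ((integrable_const (1 : ℝ)).indicator hS) fun ω => ?_
  · exact Integrable.of_bound
      ((setMissFunctional z r).continuous.measurable.comp hX).aestronglyMeasurable 1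
      (ae_of_all _ fun ω => by
        rw [Real.norm_eq_abs, abs_of_nonneg (setMissFunctional_nonneg _ _ _)]
        exact setMissFunctional_le_one _ _ _)
  · by_cases hω : ω ∈ S
    · rw [indicator_of_mem hω, Pi.one_apply]
      exact setMissFunctional_le_one _ _ _
    · rw [indicator_of_notMem hω]
      have hex : ∃ y ∈ (X ω : Set E), y ∈ ball z r := by
        by_contra h
        push Not at h
        exact hω (Set.disjoint_left.2 fun y hyb hyK => h y hyK hyb)
      obtain ⟨y, hy, hyz⟩ := hex
      exact (setMissFunctional_eq_zero hr hy (mem_ball.1 hyz)).le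

/-- **Limit side**: for a finite measure `W` and an a.e.-measurable random compact set `Z`,
`W[Z ∩ B(z, 2r) = ∅] ≤ ∫ F_{z,r}(Z) dW`. [folklore] -/
theorem measureReal_le_integral_setMissFunctional {Ω' : Type*} [MeasurableSpace Ω']
    {W : Measure Ω'} [IsFiniteMeasure W] {Z : Ω' → NonemptyCompacts E} (hZ : AEMeasurable Z W)
    {z : E} {r : ℝ} (hr : 0 < r) :
    (W {ω | Disjoint (ball z (2 * r)) (Z ω : Set E)}).toReal ≤
      ∫ ω, setMissFunctional z r (Z ω) ∂W := by
  set T : Set (NonemptyCompacts E) := {K | Disjoint (ball z (2 * r)) (K : Set E)}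
  have hT : MeasurableSet T := measurableSet_setOf_disjoint_ball z (2 * r)
  have hae : Z =ᵐ[W] hZ.mk Z := hZ.ae_eq_mk
  have hE : (Z ⁻¹' T : Set Ω') =ᵐ[W] (hZ.mk Z ⁻¹' T : Set Ω') := by
    filter_upwards [hae] with ω hω
    show (ω ∈ Z ⁻¹' T) = (ω ∈ hZ.mk Z ⁻¹' T)
    rw [mem_preimage, mem_preimage, hω]
  have hE' : MeasurableSet (hZ.mk Z ⁻¹' T) := hZ.measurable_mk hT
  have hint : Integrable (fun ω => setMissFunctional z r (hZ.mk Z ω)) W :=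
    Integrable.of_bound
      ((setMissFunctional z r).continuous.measurable.comp hZ.measurable_mk).aestronglyMeasurable 1
      (ae_of_all _ fun ω => by
        rw [Real.norm_eq_abs, abs_of_nonneg (setMissFunctional_nonneg _ _ _)]
        exact setMissFunctional_le_one _ _ _)
  calc (W {ω | Disjoint (ball z (2 * r)) (Z ω : Set E)}).toReal
      = (W (hZ.mk Z ⁻¹' T)).toReal := by
        rw [show {ω | Disjoint (ball z (2 * r)) (Z ω : Set E)} = Z ⁻¹' T from rfl,
          measure_congr hE]
    _ = ∫ ω, (hZ.mk Z ⁻¹' T).indicator 1 ω ∂W := by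
        rw [integral_indicator_one hE', measureReal_def]
    _ ≤ ∫ ω, setMissFunctional z r (hZ.mk Z ω) ∂W := by
        refine integral_mono ((integrable_const (1 : ℝ)).indicator hE') hint fun ω => ?_
        by_cases hω : ω ∈ hZ.mk Z ⁻¹' T
        · rw [indicator_of_mem hω, Pi.one_apply, setMissFunctional_eq_one hr (mem_preimage.1 hω)]
        · rw [indicator_of_notMem hω]
          exact setMissFunctional_nonneg _ _ _
    _ = ∫ ω, setMissFunctional z r (Z ω) ∂W := by
        refine integral_congr_ae ?_
        filter_upwards [hae] with ω hω
        rw [hω]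

variable {X : ∀ δ, Ωδ δ → NonemptyCompacts E} {Z : Ω' → NonemptyCompacts E}

/-- **One ball, hyperspace form.** If the random compact sets `X δ` converge in law, for the
Hausdorff (= Vietoris) topology, to `Z`, all measures being finite, and `X δ` misses the ball
`B(z, r)` with probability `→ 0`, then almost surely `dist(z, Z) ≤ r`: one-sided portmanteau
with `F_{z,r}`, `∫ F_{z,r}(Z) dW = lim ∫ F_{z,r}(X δ) dP δ = 0`. [cite: Billingsley1999, Thm 2.1] -/
theorem ae_infDist_le_of_tendstoLaw_sets [∀ δ, IsFiniteMeasure (P δ)] [IsFiniteMeasure W]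
    (hX : ∀ δ, Measurable (X δ)) (hZ : AEMeasurable Z W) (hT : TendstoLaw X P Z W)
    {z : E} {r : ℝ} (hr : 0 < r)
    (hz : Tendsto (fun δ => P δ {ω | Disjoint (ball z r) (X δ ω : Set E)}) (𝓝[>] 0) (𝓝 0)) :
    ∀ᵐ ω ∂W, infDist z (Z ω : Set E) ≤ r := by
  have hlim : Tendsto (fun δ => ∫ ω, setMissFunctional z r (X δ ω) ∂P δ) (𝓝[>] (0 : ℝ))
      (𝓝 (∫ ω, setMissFunctional z r (Z ω) ∂W)) := hT (setMissFunctional z r)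
  have hu : Tendsto (fun δ => (P δ {ω | Disjoint (ball z r) (X δ ω : Set E)}).toReal)
      (𝓝[>] (0 : ℝ)) (𝓝 0) := by
    have h := (ENNReal.tendsto_toReal ENNReal.zero_ne_top).comp hz
    rwa [ENNReal.toReal_zero] at h
  have hzero : Tendsto (fun δ => ∫ ω, setMissFunctional z r (X δ ω) ∂P δ) (𝓝[>] (0 : ℝ))
      (𝓝 0) :=
    tendsto_of_tendsto_of_tendsto_of_le_of_le tendsto_const_nhds hu
      (fun δ => integral_nonneg fun ω => setMissFunctional_nonneg _ _ _)
      (fun δ => integral_setMissFunctional_comp_le (P δ) (hX δ) hr)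
  have hL : ∫ ω, setMissFunctional z r (Z ω) ∂W = 0 := tendsto_nhds_unique hlim hzero
  have hint : Integrable (fun ω => setMissFunctional z r (Z ω)) W :=
    Integrable.of_bound
      ((setMissFunctional z r).continuous.measurable.comp_aemeasurable hZ).aestronglyMeasurable 1
      (ae_of_all _ fun ω => by
        rw [Real.norm_eq_abs, abs_of_nonneg (setMissFunctional_nonneg _ _ _)]
        exact setMissFunctional_le_one _ _ _)
  have hae : (fun ω => setMissFunctional z r (Z ω)) =ᵐ[W] 0 :=
    (integral_eq_zero_iff_of_nonneg_ae (ae_of_all _ fun ω => setMissFunctional_nonneg _ _ _)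
      hint).1 hL
  filter_upwards [hae] with ω hω
  exact infDist_le_of_setMissFunctional_eq_zero hr hω

/-- **Hyperspace limits of weakly space-filling families contain the domain.** If the random
compact sets `X δ` converge in law (Hausdorff topology) to `Z` and, for every ball
`B(z, r) ⊆ Ω` of an open set `Ω`, `X δ` misses `B(z, r)` with probability `→ 0`, then
`W`-almost surely `Ω ⊆ Z` (countably many balls; `Z` is closed). This is the mechanism of the
barrier in the hyperspace topology of random-set theory (Hausdorff = Vietoris = Fell on the
compact subsets of a fixed compact set): whatever the traces of a weakly space-filling family
converge to, as random compact SETS, contains the domain. [cite: DuminilCopinKozmaYadin2014, §1 (When x > 1/μ)] -/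
theorem ae_subset_of_tendstoLaw_sets [SeparableSpace E]
    [∀ δ, IsFiniteMeasure (P δ)] [IsFiniteMeasure W]
    (hX : ∀ δ, Measurable (X δ)) (hZ : AEMeasurable Z W) (hT : TendstoLaw X P Z W)
    {Ω : Set E} (hΩ : IsOpen Ω)
    (hfill : ∀ (z : E) (r : ℝ), 0 < r → ball z r ⊆ Ω →
      Tendsto (fun δ => P δ {ω | Disjoint (ball z r) (X δ ω : Set E)}) (𝓝[>] 0) (𝓝 0)) :
    ∀ᵐ ω ∂W, Ω ⊆ (Z ω : Set E) := by
  obtain ⟨Dd, hDc, hDd⟩ := TopologicalSpace.exists_countable_dense E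
  haveI : Countable ↥(Dd ∩ Ω) := (hDc.mono inter_subset_left).to_subtype
  have hball : ∀ (q : ↥(Dd ∩ Ω)) (n : ℕ), ∀ᵐ ω ∂W,
      ball (q : E) (1 / ((n : ℝ) + 1)) ⊆ Ω → infDist (q : E) (Z ω : Set E) ≤ 1 / ((n : ℝ) + 1) := by
    intro q n
    by_cases hq : ball (q : E) (1 / ((n : ℝ) + 1)) ⊆ Ω
    · filter_upwards [ae_infDist_le_of_tendstoLaw_sets hX hZ hT (by positivity)
        (hfill _ _ (by positivity) hq)] with ω hω _ using hω
    · exact ae_of_all _ fun ω h => absurd h hq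
  have hall : ∀ᵐ ω ∂W, ∀ (q : ↥(Dd ∩ Ω)) (n : ℕ),
      ball (q : E) (1 / ((n : ℝ) + 1)) ⊆ Ω → infDist (q : E) (Z ω : Set E) ≤ 1 / ((n : ℝ) + 1) := by
    rw [ae_all_iff]
    intro q
    rw [ae_all_iff]
    exact hball q
  filter_upwards [hall] with ω hω
  intro z hz
  rw [← (Z ω).isCompact.isClosed.closure_eq, Metric.mem_closure_iff]
  intro ε hε
  obtain ⟨ρ, hρ, hρΩ⟩ := Metric.isOpen_iff.1 hΩ z hz
  set ρ' : ℝ := min (ρ / 2) (ε / 2) with hρ'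
  have hρ'pos : 0 < ρ' := lt_min (by linarith) (by linarith)
  obtain ⟨q, hqD, hzq⟩ := hDd.exists_dist_lt z hρ'pos
  have hqΩ : q ∈ Ω := hρΩ (mem_ball'.2 (hzq.trans_le ((min_le_left _ _).trans (by linarith))))
  obtain ⟨n, hn⟩ := exists_nat_one_div_lt hρ'pos
  have hsub : ball q (1 / ((n : ℝ) + 1)) ⊆ Ω := by
    refine Subset.trans ?_ hρΩ
    intro y hy
    rw [mem_ball] at hy ⊢
    calc dist y z ≤ dist y q + dist q z := dist_triangle _ _ _
      _ < 1 / ((n : ℝ) + 1) + ρ' := by rw [dist_comm q z]; exact add_lt_add hy hzq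
      _ ≤ ρ' + ρ' := by linarith
      _ ≤ ρ := by linarith [min_le_left (ρ / 2) (ε / 2)]
  have hq := hω ⟨q, hqD, hqΩ⟩ n hsub
  have hlt : infDist q (Z ω : Set E) < ρ' := hq.trans_lt hn
  obtain ⟨y, hy, hqy⟩ := (infDist_lt_iff (Z ω).nonempty).1 hlt
  refine ⟨y, hy, ?_⟩
  calc dist z y ≤ dist z q + dist q y := dist_triangle _ _ _
    _ < ρ' + ρ' := add_lt_add hzq hqy
    _ ≤ ε := by linarith [min_le_right (ρ / 2) (ε / 2)]

/-- Under the same hypotheses the limit even contains `closure Ω` (it is closed). [folklore] -/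
theorem ae_closure_subset_of_tendstoLaw_sets [SeparableSpace E]
    [∀ δ, IsFiniteMeasure (P δ)] [IsFiniteMeasure W]
    (hX : ∀ δ, Measurable (X δ)) (hZ : AEMeasurable Z W) (hT : TendstoLaw X P Z W)
    {Ω : Set E} (hΩ : IsOpen Ω)
    (hfill : ∀ (z : E) (r : ℝ), 0 < r → ball z r ⊆ Ω →
      Tendsto (fun δ => P δ {ω | Disjoint (ball z r) (X δ ω : Set E)}) (𝓝[>] 0) (𝓝 0)) :
    ∀ᵐ ω ∂W, closure Ω ⊆ (Z ω : Set E) := by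
  filter_upwards [ae_subset_of_tendstoLaw_sets hX hZ hT hΩ hfill] with ω hω
  exact (Z ω).isCompact.isClosed.closure_subset_iff.2 hω

/-- **The mechanism in its sharp hyperspace form**: if `Z` is NOT almost surely a superset of
`Ω`, the family does not converge in law to `Z` as random compact sets. [cite: DuminilCopinKozmaYadin2014, §1 (When x > 1/μ)] -/
theorem not_tendstoLaw_sets_of_not_ae_subset [SeparableSpace E]
    [∀ δ, IsFiniteMeasure (P δ)] [IsFiniteMeasure W]
    (hX : ∀ δ, Measurable (X δ)) (hZ : AEMeasurable Z W) {Ω : Set E} (hΩ : IsOpen Ω)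
    (hfill : ∀ (z : E) (r : ℝ), 0 < r → ball z r ⊆ Ω →
      Tendsto (fun δ => P δ {ω | Disjoint (ball z r) (X δ ω : Set E)}) (𝓝[>] 0) (𝓝 0))
    (hnot : ¬ ∀ᵐ ω ∂W, Ω ⊆ (Z ω : Set E)) : ¬ TendstoLaw X P Z W :=
  fun hT => hnot (ae_subset_of_tendstoLaw_sets hX hZ hT hΩ hfill)

end Hyperspace

/-! ### The curve-topology mechanism recovered from the hyperspace one -/

section CurveCorollary

variable {E : Type*} [MetricSpace E] [MeasurableSpace (NonemptyCompacts E)]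
  [BorelSpace (NonemptyCompacts E)]
  {Ωδ : ℝ → Type*} [∀ δ, MeasurableSpace (Ωδ δ)] {P : ∀ δ, Measure (Ωδ δ)}
  {Ω' : Type*} [MeasurableSpace Ω'] {W : Measure Ω'}

/-- The curve-topology statement of `…ProofsNarrow` (`ae_subset_range_of_tendstoLaw`) recovered
from the hyperspace one. [cite: DuminilCopinKozmaYadin2014, §1 (When x > 1/μ)] -/
theorem ae_subset_range_of_tendstoLaw' [SeparableSpace E]
    [∀ δ, IsFiniteMeasure (P δ)] [IsFiniteMeasure W]
    {Y : ∀ δ, Ωδ δ → CurveClass E} {Γ : Ω' → CurveClass E}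
    (hY : ∀ δ, Measurable (Y δ)) (hΓ : AEMeasurable Γ W) (hT : TendstoLaw Y P Γ W)
    {Ω : Set E} (hΩ : IsOpen Ω)
    (hfill : ∀ (z : E) (r : ℝ), 0 < r → ball z r ⊆ Ω →
      Tendsto (fun δ => P δ {ω | Disjoint (ball z r) (Y δ ω).range}) (𝓝[>] 0) (𝓝 0)) :
    ∀ᵐ ω ∂W, Ω ⊆ (Γ ω).range :=
  ae_subset_of_tendstoLaw_sets (fun δ => continuous_traceNC.measurable.comp (hY δ))
    (continuous_traceNC.measurable.comp_aemeasurable hΓ) (tendstoLaw_traceNC_of_tendstoLaw hT)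
    hΩ hfill

end CurveCorollary

/-! ### The hyperspace limit of a weakly space-filling family is deterministic -/

section Deterministic

variable {E : Type*} [MetricSpace E]
  {Ωδ : ℝ → Type*} [∀ δ, MeasurableSpace (Ωδ δ)] {P : ∀ δ, Measure (Ωδ δ)}
  {X : ∀ δ, Ωδ δ → NonemptyCompacts E}

/-- **Weak space-filling is convergence in probability, in the Hausdorff metric, to the closed
domain.** If the random compact sets `X δ` lie in `closure Ω` for a relatively compact open set
`Ω` and miss every ball `B(z, r) ⊆ Ω` with probability `→ 0`, then for every `r > 0` the
probability that `d_H(X δ, closure Ω) > r` tends to `0`: cover the compact set `closure Ω` by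
finitely many balls `B(zᵢ, r/2)` with `zᵢ ∈ Ω`, shrink each to a ball `B(zᵢ, ρᵢ) ⊆ Ω`,
`ρᵢ ≤ r/2`; off the finite union of the miss events every point of `closure Ω` is within `r` of
`X δ`. So in the hyperspace topology a weakly space-filling family HAS a scaling limit, the
point mass at `closure Ω`, and carries no further information. [cite: DuminilCopinKozmaYadin2014, §1 (When x > 1/μ)] -/
theorem tendsto_measure_lt_hausdorffDist_of_forall_ball {Ω : Set E} (hΩ : IsOpen Ω)
    (hΩc : IsCompact (closure Ω))
    (hsub : ∀ δ ω, (X δ ω : Set E) ⊆ closure Ω)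
    (hfill : ∀ (z : E) (r : ℝ), 0 < r → ball z r ⊆ Ω →
      Tendsto (fun δ => P δ {ω | Disjoint (ball z r) (X δ ω : Set E)}) (𝓝[>] 0) (𝓝 0))
    {r : ℝ} (hr : 0 < r) :
    Tendsto (fun δ => P δ {ω | r < hausdorffDist (X δ ω : Set E) (closure Ω)}) (𝓝[>] 0) (𝓝 0) := by
  -- a finite cover of `closure Ω` by balls of radius `r/2` centred in `Ω`
  have hcover : closure Ω ⊆ ⋃ z ∈ Ω, ball z (r / 2) := by
    intro w hw
    obtain ⟨z, hz, hwz⟩ := Metric.mem_closure_iff.1 hw (r / 2) (by positivity)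
    exact mem_iUnion₂.2 ⟨z, hz, mem_ball.2 hwz⟩
  obtain ⟨t, htΩ, htfin, htcov⟩ :=
    hΩc.elim_finite_subcover_image (fun z _ => isOpen_ball) hcover
  -- shrink each ball into `Ω`
  have hρ : ∀ z ∈ t, ∃ ρ : ℝ, 0 < ρ ∧ ρ ≤ r / 2 ∧ ball z ρ ⊆ Ω := by
    intro z hz
    obtain ⟨ρ, hρ, hρΩ⟩ := Metric.isOpen_iff.1 hΩ z (htΩ hz)
    exact ⟨min ρ (r / 2), lt_min hρ (by positivity), min_le_right _ _,
      (ball_subset_ball (min_le_left _ _)).trans hρΩ⟩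
  choose! ρ hρpos hρle hρΩ using hρ
  -- off the miss events, the Hausdorff distance is at most `r`
  have hincl : ∀ δ, {ω | r < hausdorffDist (X δ ω : Set E) (closure Ω)} ⊆
      ⋃ z ∈ htfin.toFinset, {ω | Disjoint (ball z (ρ z)) (X δ ω : Set E)} := by
    intro δ ω hω
    by_contra hno
    simp only [mem_iUnion, mem_setOf_eq, exists_prop, not_exists, not_and,
      Set.Finite.mem_toFinset] at hno
    have hle : hausdorffDist (X δ ω : Set E) (closure Ω) ≤ r := by
      refine hausdorffDist_le_of_infDist hr.le (fun y hy => ?_) (fun w hw => ?_)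
      · rw [infDist_zero_of_mem (hsub δ ω hy)]
        exact hr.le
      · obtain ⟨z, hz, hwz⟩ := mem_iUnion₂.1 (htcov hw)
        have hmeet : ¬ Disjoint (ball z (ρ z)) (X δ ω : Set E) := hno z hz
        obtain ⟨y, hyb, hyX⟩ : ∃ y ∈ ball z (ρ z), y ∈ (X δ ω : Set E) := by
          by_contra h
          push Not at h
          exact hmeet (Set.disjoint_left.2 fun y hyb hyX => h y hyb hyX)
        refine (infDist_le_dist_of_mem hyX).trans ?_
        calc dist w y ≤ dist w z + dist z y := dist_triangle _ _ _
          _ ≤ r / 2 + r / 2 := by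
              refine add_le_add (mem_ball.1 hwz).le ?_
              rw [dist_comm]
              exact ((mem_ball.1 hyb).le.trans (hρle z hz))
          _ = r := by ring
    exact (not_lt.2 hle) hω
  -- the finite sum of the miss probabilities tends to `0`
  have hsum : Tendsto (fun δ => ∑ z ∈ htfin.toFinset, P δ {ω | Disjoint (ball z (ρ z)) (X δ ω : Set E)})
      (𝓝[>] 0) (𝓝 0) := by
    have h := tendsto_finsetSum htfin.toFinset
      (f := fun z δ => P δ {ω | Disjoint (ball z (ρ z)) (X δ ω : Set E)})
      (fun z hz => hfill z (ρ z) (hρpos z (htfin.mem_toFinset.1 hz))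
        (hρΩ z (htfin.mem_toFinset.1 hz)))
    simpa using h
  refine tendsto_of_tendsto_of_tendsto_of_le_of_le tendsto_const_nhds hsum
    (fun _ => bot_le) fun δ => ?_
  exact (measure_mono (hincl δ)).trans (measure_biUnion_finset_le _ _)

end Deterministic


/-! ### Convergence in probability to a constant is convergence in law to a point mass -/

section ConstLimit

variable {S : Type*} [PseudoMetricSpace S]
  {Ωδ : ℝ → Type*} [∀ δ, MeasurableSpace (Ωδ δ)] {P : ∀ δ, Measure (Ωδ δ)}
  {X : ∀ δ, Ωδ δ → S}

/-- **Convergence in probability to a constant implies convergence in law to it** (eventually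
probability measures; bounded continuous test functions): split `|f(X) - f(K₀)|` according to
`dist(X, K₀) ≶ η`, `η` a continuity modulus of `f` at `K₀`. [cite: Billingsley1999, Thm 2.1] -/
theorem tendstoLaw_const_of_tendsto_measure_lt_dist [∀ δ, IsFiniteMeasure (P δ)]
    (hP : ∀ᶠ δ in 𝓝[>] (0 : ℝ), IsProbabilityMeasure (P δ))
    (hX : ∀ δ (f : S →ᵇ ℝ), AEStronglyMeasurable (fun ω => f (X δ ω)) (P δ)) (K₀ : S)
    (hconv : ∀ η : ℝ, 0 < η →
      Tendsto (fun δ => P δ {ω | η < dist (X δ ω) K₀}) (𝓝[>] 0) (𝓝 0))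
    {Ω' : Type*} [MeasurableSpace Ω'] (W : Measure Ω') [IsProbabilityMeasure W] :
    TendstoLaw X P (fun _ : Ω' => K₀) W := by
  intro f
  simp only [integral_const, probReal_univ, one_smul]
  rw [Metric.tendsto_nhds]
  intro ε hε
  obtain ⟨η, hη, hfη⟩ := Metric.continuous_iff.1 f.continuous K₀ (ε / 2) (half_pos hε)
  set C : ℝ := ‖f‖ with hC
  have hC0 : 0 ≤ C := norm_nonneg _
  have hq : 0 < ε / (4 * (C + 1)) := by positivity
  have hsmall : ∀ᶠ δ in 𝓝[>] (0 : ℝ),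
      P δ {ω | η / 2 < dist (X δ ω) K₀} < ENNReal.ofReal (ε / (4 * (C + 1))) :=
    (hconv (η / 2) (half_pos hη)).eventually (gt_mem_nhds (ENNReal.ofReal_pos.2 hq))
  filter_upwards [hP, hsmall] with δ hPδ hδ
  haveI := hPδ
  set B : Set (Ωδ δ) := {ω | η / 2 < dist (X δ ω) K₀} with hB
  set B' : Set (Ωδ δ) := toMeasurable (P δ) B with hB'
  have hB'm : MeasurableSet B' := measurableSet_toMeasurable _ _
  have hPB' : P δ B' = P δ B := measure_toMeasurable B
  -- pointwise bound
  have hpt : ∀ ω, |f (X δ ω) - f K₀| ≤ ε / 2 + 2 * C * B'.indicator 1 ω := by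
    intro ω
    by_cases hω : ω ∈ B'
    · rw [indicator_of_mem hω, Pi.one_apply, mul_one]
      have h1 : |f (X δ ω) - f K₀| ≤ |f (X δ ω)| + |f K₀| := abs_sub _ _
      have h2 : |f (X δ ω)| ≤ C := by
        have := f.norm_coe_le_norm (X δ ω)
        rwa [Real.norm_eq_abs] at this
      have h3 : |f K₀| ≤ C := by
        have := f.norm_coe_le_norm K₀
        rwa [Real.norm_eq_abs] at this
      linarith
    · have hωB : ω ∉ B := fun h => hω (subset_toMeasurable _ _ h)
      have hdist : dist (X δ ω) K₀ < η := by
        have hle : dist (X δ ω) K₀ ≤ η / 2 := not_lt.1 hωB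
        linarith
      have h := hfη (X δ ω) hdist
      rw [Real.dist_eq] at h
      rw [indicator_of_notMem hω, mul_zero, add_zero]
      exact h.le
  -- integrate the bound
  have hint : Integrable (fun ω => f (X δ ω)) (P δ) :=
    Integrable.of_bound (hX δ f) C (ae_of_all _ fun ω => f.norm_coe_le_norm (X δ ω))
  have h1i : Integrable (B'.indicator (1 : Ωδ δ → ℝ)) (P δ) :=
    (integrable_const (1 : ℝ)).indicator hB'm
  have hgi : Integrable (fun ω => 2 * C * B'.indicator 1 ω) (P δ) := h1i.const_mul (2 * C)
  have hind : Integrable (fun ω => ε / 2 + 2 * C * B'.indicator 1 ω) (P δ) :=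
    (integrable_const _).add hgi
  have hsplit : ∫ ω, (ε / 2 + 2 * C * B'.indicator 1 ω) ∂P δ =
      (∫ _ω, (ε / 2 : ℝ) ∂P δ) + ∫ ω, 2 * C * B'.indicator 1 ω ∂P δ :=
    integral_add (integrable_const _) hgi
  have hPB : (P δ B').toReal < ε / (4 * (C + 1)) := by
    rw [hPB']
    exact ENNReal.toReal_lt_of_lt_ofReal hδ
  rw [Real.dist_eq]
  calc |∫ ω, f (X δ ω) ∂P δ - f K₀|
      = |∫ ω, (f (X δ ω) - f K₀) ∂P δ| := by
        rw [integral_sub hint (integrable_const _), integral_const, probReal_univ,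
          one_smul]
    _ ≤ ∫ ω, |f (X δ ω) - f K₀| ∂P δ := abs_integral_le_integral_abs
    _ ≤ ∫ ω, (ε / 2 + 2 * C * B'.indicator 1 ω) ∂P δ :=
        integral_mono (hint.sub (integrable_const _)).abs hind hpt
    _ = ε / 2 + 2 * C * (P δ B').toReal := by
        rw [hsplit, integral_const, probReal_univ, one_smul, integral_const_mul,
          integral_indicator_one hB'm, measureReal_def]
    _ ≤ ε / 2 + 2 * C * (ε / (4 * (C + 1))) := by gcongr
    _ < ε := by
        have hC1 : C / (C + 1) < 1 := (div_lt_one (by linarith)).2 (by linarith)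
        have : 2 * C * (ε / (4 * (C + 1))) = ε / 2 * (C / (C + 1)) := by
          field_simp
          ring
        rw [this]
        nlinarith [mul_lt_mul_of_pos_left hC1 (half_pos hε)]

end ConstLimit

/-! ### Specialisation to SAW laws: the trace of the walk as a random compact set -/

section SAWLaws

variable {Ω : Set ℂ} {δ : ℝ} {a b : Site 2}

/-- The polyline of a walk lies in every convex set containing its embedded vertices.
[folklore] -/
theorem range_toCurve_subset_of_convex {V F : Type*} [NormedAddCommGroup F] [NormedSpace ℝ F]
    {G : SimpleGraph V} (emb : V → F) {C : Set F} (hC : Convex ℝ C) :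
    ∀ {u v : V} (p : G.Walk u v), (∀ w ∈ p.support, emb w ∈ C) → Set.range (p.toCurve emb) ⊆ C
  | _, _, SimpleGraph.Walk.nil, h => by
    rw [range_toCurve_nil_eq]
    exact singleton_subset_iff.2 (h _ (by simp))
  | _, _, SimpleGraph.Walk.cons hadj p, h => by
    rw [range_toCurve_cons_eq]
    refine union_subset (hC.segment_subset (h _ (by simp)) (h _ ?_)) ?_
    · rw [SimpleGraph.Walk.support_cons]
      exact List.mem_cons_of_mem _ p.start_mem_support
    · exact range_toCurve_subset_of_convex emb hC p fun w hw =>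
        h w (by rw [SimpleGraph.Walk.support_cons]; exact List.mem_cons_of_mem _ hw)

/-- **The trace of a SAW of the unit disc lies in the open unit disc** (convexity), provided its
starting site is a site of `𝔻_δ`. [folklore] -/
theorem range_curve_subset_unitDisk {γ : DomainSAW unitDisk δ a b} (ha : a ∈ meshDomain unitDisk δ) :
    γ.curve.range ⊆ unitDisk := by
  have hsub : ∀ u ∈ γ.walk.support, u ∈ meshDomain unitDisk δ :=
    walk_support_subset_meshDomain γ.walk ha
  exact range_toCurve_subset_of_convex (G := discreteDomainGraph unitDisk δ) (meshPoint δ)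
    (convex_ball (0 : ℂ) 1) γ.walk fun w hw => meshPoint_mem_of_mem_meshDomain (hsub w hw)

/-- The unit disc is open. [folklore] -/
theorem isOpen_unitDisk : IsOpen unitDisk :=
  isOpen_ball

/-- The closure of the unit disc is the closed unit disc. [folklore] -/
theorem closure_unitDisk : closure unitDisk = closedBall (0 : ℂ) 1 :=
  closure_ball 0 one_ne_zero

variable [MeasurableSpace (NonemptyCompacts ℂ)] [OpensMeasurableSpace (NonemptyCompacts ℂ)]
  {A B : ℝ → Site 2} {P : ∀ δ : ℝ, Measure (DomainSAW Ω δ (A δ) (B δ))}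

omit [MeasurableSpace (NonemptyCompacts ℂ)] [OpensMeasurableSpace (NonemptyCompacts ℂ)] in
/-- For SAW laws the printed vertex form of weak space-filling ("`γ_δ ∩ U = ∅`" read on visited
mesh points, `IsSpaceFillingLaws`) gives the miss events of the traces: a trace missing a ball
visits no mesh point in it. [cite: DuminilCopinKozmaYadin2014, §1 (When x > 1/μ)] -/
theorem IsSpaceFillingLaws.tendsto_measure_disjoint_ball_traceNC (hfill : IsSpaceFillingLaws Ω A B P)
    {z : ℂ} {r : ℝ} (hr : 0 < r) (hball : ball z r ⊆ Ω) :
    Tendsto (fun δ => P δ {γ | Disjoint (ball z r) (traceNC (DomainSAW.curve γ) : Set ℂ)})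
      (𝓝[>] 0) (𝓝 0) := by
  refine tendsto_of_tendsto_of_tendsto_of_le_of_le tendsto_const_nhds
    (hfill (ball z r) isOpen_ball hball ⟨z, mem_ball_self hr⟩) (fun _ => bot_le) fun δ => ?_
  refine measure_mono fun γ hγ v hv hvz => ?_
  exact Set.disjoint_left.1 hγ hvz (meshPoint_mem_range_curve γ hv)

/-- **Hyperspace limits of weakly space-filling SAW laws contain the closed domain.** If the
finite laws `P δ` on the SAWs of `Ω_δ` from `A δ` to `B δ` are weakly space-filling in the open
set `Ω` (§1 of the source) and the traces converge in law, AS RANDOM COMPACT SETS (Hausdorff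
topology), to `Z` under a finite measure `W`, then `W`-a.s. `closure Ω ⊆ Z`. No curve topology,
no parametrisation, no SLE input. [cite: DuminilCopinKozmaYadin2014, §1 (When x > 1/μ)] -/
theorem IsSpaceFillingLaws.ae_closure_subset_of_tendstoLaw_sets [∀ δ, IsFiniteMeasure (P δ)]
    (hΩ : IsOpen Ω) (hfill : IsSpaceFillingLaws Ω A B P) {Ω' : Type*} [MeasurableSpace Ω']
    {W : Measure Ω'} [IsFiniteMeasure W] {Z : Ω' → NonemptyCompacts ℂ} (hZ : AEMeasurable Z W)
    (hT : TendstoLaw (fun δ (γ : DomainSAW Ω δ (A δ) (B δ)) => traceNC γ.curve) P Z W) :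
    ∀ᵐ ω ∂W, closure Ω ⊆ (Z ω : Set ℂ) :=
  SupercriticalSAW.ae_closure_subset_of_tendstoLaw_sets (fun _ => DomainSAW.measurable_of_top _)
    hZ hT hΩ fun _ _ hr hball => hfill.tendsto_measure_disjoint_ball_traceNC hr hball

/-- **No hyperspace scaling limit of a weakly space-filling SAW family has a non-trivial
avoidance functional**: if some ball `B(z, 2r)` with `B(z, r) ⊆ Ω` is missed by `Z` with
positive `W`-measure, the traces do not converge in law to `Z` as random compact sets.
[cite: DuminilCopinKozmaYadin2014, §1 (When x > 1/μ)] -/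
theorem IsSpaceFillingLaws.not_tendstoLaw_sets [∀ δ, IsFiniteMeasure (P δ)]
    (hΩ : IsOpen Ω) (hfill : IsSpaceFillingLaws Ω A B P) {Ω' : Type*} [MeasurableSpace Ω']
    {W : Measure Ω'} [IsFiniteMeasure W] {Z : Ω' → NonemptyCompacts ℂ} (hZ : AEMeasurable Z W)
    {z : ℂ} {r : ℝ} (hr : 0 < r) (hball : ball z r ⊆ Ω)
    (hpos : W {ω | Disjoint (ball z (2 * r)) (Z ω : Set ℂ)} ≠ 0) :
    ¬ TendstoLaw (fun δ (γ : DomainSAW Ω δ (A δ) (B δ)) => traceNC γ.curve) P Z W :=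
  not_tendstoLaw_sets_of_not_ae_subset (fun _ => DomainSAW.measurable_of_top _) hZ hΩ
    (fun _ _ hr' hball' => hfill.tendsto_measure_disjoint_ball_traceNC hr' hball')
    (not_ae_subset_of_measure_ne_zero_sets hr hball hpos)

end SAWLaws

/-! ### The supercritical walk of the unit disc, unconditionally -/

section Supercritical

variable {A B : ℝ → Site 2} {x : ℝ} {a b : ℂ}

/-- **The supercritical trace converges in probability, in the Hausdorff metric, to the closed
unit disc.** For every `x > x_c`, boundary points `a ≠ b` of `𝔻` and closest-site endpoints
`a_δ, b_δ` (the setting of Theorem 1 of the source, proved in the tree as `DKY2014_thm1_holds`):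
for every `r > 0`, `P_{(𝔻_δ,a_δ,b_δ,x)}[d_H(trace γ_δ, 𝔻̄) > r] → 0` as `δ → 0⁺`.
[cite: DuminilCopinKozmaYadin2014, Theorem 1] -/
theorem tendsto_lawAt_lt_hausdorffDist_closedDisk (hx : criticalFugacity < x) (ha : ‖a‖ = 1)
    (hb : ‖b‖ = 1) (hab : a ≠ b)
    (hAB : ∀ δ : ℝ, 0 < δ → IsClosestSite unitDisk δ a (A δ) ∧ IsClosestSite unitDisk δ b (B δ))
    {r : ℝ} (hr : 0 < r) :
    Tendsto (fun δ => lawAt x unitDisk δ (A δ) (B δ)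
        {γ | r < hausdorffDist γ.curve.range (closedBall (0 : ℂ) 1)}) (𝓝[>] 0) (𝓝 0) := by
  have hfill : IsSpaceFillingLaws unitDisk A B (fun δ => lawAt x unitDisk δ (A δ) (B δ)) :=
    isSpaceFillingLaws_lawAt_iff.2 (isSpaceFillingFamily_of_DKY2014_thm1 DKY2014_thm1_holds ha hb hab hAB hx)
  -- restrict to `δ > 0`, where the traces lie in the disc; at `δ ≤ 0` use the zero family
  let X : ∀ δ : ℝ, DomainSAW unitDisk δ (A δ) (B δ) → NonemptyCompacts ℂ := fun δ γ =>
    if 0 < δ then traceNC γ.curve else ⟨⟨{0}, isCompact_singleton⟩, singleton_nonempty 0⟩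
  have hX : ∀ δ, 0 < δ → ∀ γ : DomainSAW unitDisk δ (A δ) (B δ), X δ γ = traceNC γ.curve := by
    intro δ hδ γ
    simp only [X, if_pos hδ]
  have hsub : ∀ δ γ, (X δ γ : Set ℂ) ⊆ closure unitDisk := by
    intro δ γ
    by_cases hδ : 0 < δ
    · rw [hX δ hδ γ, coe_traceNC]
      exact (range_curve_subset_unitDisk (hAB δ hδ).1.1).trans subset_closure
    · simp only [X, if_neg hδ]
      intro w hw
      rw [NonemptyCompacts.coe_mk, Compacts.coe_mk, mem_singleton_iff] at hw
      rw [hw]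
      exact subset_closure (by simp [unitDisk])
  have hfill' : ∀ (z : ℂ) (ρ : ℝ), 0 < ρ → ball z ρ ⊆ unitDisk →
      Tendsto (fun δ => lawAt x unitDisk δ (A δ) (B δ) {γ | Disjoint (ball z ρ) (X δ γ : Set ℂ)})
        (𝓝[>] 0) (𝓝 0) := by
    intro z ρ hρ hballΩ
    refine (hfill.tendsto_measure_disjoint_ball_traceNC hρ hballΩ).congr' ?_
    filter_upwards [self_mem_nhdsWithin] with δ hδ
    simp only [hX δ hδ]
  have h := tendsto_measure_lt_hausdorffDist_of_forall_ball
    (P := fun δ => lawAt x unitDisk δ (A δ) (B δ)) isOpen_unitDisk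
    (by rw [closure_unitDisk]; exact isCompact_closedBall 0 1) hsub hfill' hr
  refine h.congr' ?_
  filter_upwards [self_mem_nhdsWithin] with δ hδ
  simp only [hX δ hδ, coe_traceNC, closure_unitDisk]


/-- **Conversely, Hausdorff convergence in probability to the closed disc implies the weak
space-filling property of §1** (any fugacity, any endpoints): if `B(z, ρ) ⊆ U` and
`d_H(trace γ_δ, 𝔻̄) ≤ ρ/2` with `δ < ρ/2`, some point of the polyline is within `ρ/2` of `z` and
some visited mesh point within `ρ/2 + δ < ρ`, i.e. in `U`. So at the lattice level the printed
weak space-filling property IS the statement "the trace converges in probability, in the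
Hausdorff metric, to `𝔻̄`". [cite: DuminilCopinKozmaYadin2014, §1 (When x > 1/μ)] -/
theorem isSpaceFillingFamily_of_tendsto_hausdorffDist
    (h : ∀ r : ℝ, 0 < r → Tendsto (fun δ => lawAt x unitDisk δ (A δ) (B δ)
        {γ | r < hausdorffDist γ.curve.range (closedBall (0 : ℂ) 1)}) (𝓝[>] 0) (𝓝 0)) :
    IsSpaceFillingFamily x unitDisk A B := by
  rintro U hU hUΩ ⟨z, hz⟩
  obtain ⟨ρ, hρ, hzρ⟩ := Metric.isOpen_iff.1 hU z hz
  have hsmall : ∀ᶠ δ in 𝓝[>] (0 : ℝ), δ ∈ Ioo 0 (ρ / 2) := Ioo_mem_nhdsGT (half_pos hρ)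
  refine tendsto_of_tendsto_of_tendsto_of_le_of_le' tendsto_const_nhds (h (ρ / 2) (half_pos hρ))
    (Eventually.of_forall fun _ => bot_le) ?_
  filter_upwards [hsmall] with δ hδ
  refine measure_mono fun γ hγ => ?_
  simp only [mem_setOf_eq] at hγ ⊢
  by_contra hle
  push Not at hle
  have hzD : z ∈ closedBall (0 : ℂ) 1 := ball_subset_closedBall (hUΩ (hzρ (mem_ball_self hρ)))
  have hfin : Metric.hausdorffEDist γ.curve.range (closedBall (0 : ℂ) 1) ≠ ⊤ :=
    hausdorffEDist_ne_top_of_nonempty_of_bounded γ.curve.range_nonempty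
      ⟨0, mem_closedBall_self zero_le_one⟩ γ.curve.isCompact_range.isBounded isBounded_closedBall
  have hlt : hausdorffDist γ.curve.range (closedBall (0 : ℂ) 1) < ρ - δ := by
    have := hδ.2; linarith
  obtain ⟨y, hy, hyz⟩ := exists_dist_lt_of_hausdorffDist_lt' hzD hlt hfin
  obtain ⟨v, hv, hyv⟩ := mem_iUnion₂.1 (range_curve_subset_iUnion_closedBall hδ.1.le γ hy)
  refine hγ v hv (hzρ (mem_ball.2 ?_))
  calc dist (meshPoint δ v) z ≤ dist (meshPoint δ v) y + dist y z := dist_triangle _ _ _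
    _ < δ + (ρ - δ) := by
        refine add_lt_add_of_le_of_lt ?_ hyz
        rw [dist_comm]; exact hyv
    _ = ρ := by ring

variable [MeasurableSpace (NonemptyCompacts ℂ)] [OpensMeasurableSpace (NonemptyCompacts ℂ)]

/-- **Every hyperspace scaling limit of the supercritical trace is the closed disc.** In the
setting of Theorem 1, if the traces converge in law, as random compact sets, to `Z` under a
finite measure `W`, then `W`-a.s. `𝔻̄ ⊆ Z`. [cite: DuminilCopinKozmaYadin2014, Theorem 1] -/
theorem ae_closedDisk_subset_of_tendstoLaw_sets_supercritical (hx : criticalFugacity < x)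
    (ha : ‖a‖ = 1) (hb : ‖b‖ = 1) (hab : a ≠ b)
    (hAB : ∀ δ : ℝ, 0 < δ → IsClosestSite unitDisk δ a (A δ) ∧ IsClosestSite unitDisk δ b (B δ))
    {Ω' : Type*} [MeasurableSpace Ω'] {W : Measure Ω'} [IsFiniteMeasure W]
    {Z : Ω' → NonemptyCompacts ℂ} (hZ : AEMeasurable Z W)
    (hT : TendstoLaw (fun δ (γ : DomainSAW unitDisk δ (A δ) (B δ)) => traceNC γ.curve)
      (fun δ => lawAt x unitDisk δ (A δ) (B δ)) Z W) :
    ∀ᵐ ω ∂W, closedBall (0 : ℂ) 1 ⊆ (Z ω : Set ℂ) := by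
  have hfill : IsSpaceFillingLaws unitDisk A B (fun δ => lawAt x unitDisk δ (A δ) (B δ)) :=
    isSpaceFillingLaws_lawAt_iff.2 (isSpaceFillingFamily_of_DKY2014_thm1 DKY2014_thm1_holds ha hb hab hAB hx)
  have h := hfill.ae_closure_subset_of_tendstoLaw_sets isOpen_unitDisk hZ hT
  rwa [closure_unitDisk] at h

/-- **The barrier in the hyperspace topology, unconditionally**: for `x > x_c` the traces of the
supercritical walk of `(𝔻; a, b)` (closest-site endpoints) converge in law, as random compact
sets, to NO random compact set that misses some ball `B(z, 2r)`, `B(z, r) ⊆ 𝔻`, with positive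
probability — in particular to the trace of no chordal SLE_κ with `κ < 8`, to no restriction
hull, to no random set of dimension `< 2`. [cite: DuminilCopinKozmaYadin2014, Theorem 1] -/
theorem not_tendstoLaw_sets_supercritical (hx : criticalFugacity < x) (ha : ‖a‖ = 1)
    (hb : ‖b‖ = 1) (hab : a ≠ b)
    (hAB : ∀ δ : ℝ, 0 < δ → IsClosestSite unitDisk δ a (A δ) ∧ IsClosestSite unitDisk δ b (B δ))
    {Ω' : Type*} [MeasurableSpace Ω'] {W : Measure Ω'} [IsFiniteMeasure W]
    {Z : Ω' → NonemptyCompacts ℂ} (hZ : AEMeasurable Z W) {z : ℂ} {r : ℝ} (hr : 0 < r)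
    (hball : ball z r ⊆ unitDisk) (hpos : W {ω | Disjoint (ball z (2 * r)) (Z ω : Set ℂ)} ≠ 0) :
    ¬ TendstoLaw (fun δ (γ : DomainSAW unitDisk δ (A δ) (B δ)) => traceNC γ.curve)
      (fun δ => lawAt x unitDisk δ (A δ) (B δ)) Z W := by
  have hfill : IsSpaceFillingLaws unitDisk A B (fun δ => lawAt x unitDisk δ (A δ) (B δ)) :=
    isSpaceFillingLaws_lawAt_iff.2 (isSpaceFillingFamily_of_DKY2014_thm1 DKY2014_thm1_holds ha hb hab hAB hx)
  exact hfill.not_tendstoLaw_sets isOpen_unitDisk hZ hr hball hpos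


omit [MeasurableSpace (NonemptyCompacts ℂ)] [OpensMeasurableSpace (NonemptyCompacts ℂ)] in
/-- **In the hyperspace topology the supercritical scaling limit EXISTS and is trivial**: for
`x > x_c`, boundary points `a ≠ b` and closest-site endpoints, the traces of the fugacity-`x`
walk of the unit disc converge in law, as random compact sets, to the point mass at the closed
disc `𝔻̄` (any probability space carrying the constant). The weak space-filling property of §1
of the source is thus EQUIVALENT to a convergence statement, and the Hausdorff topology sees
nothing else of the supercritical phase (Conjecture 11's SLE₈ structure is invisible to it).
[cite: DuminilCopinKozmaYadin2014, Theorem 1 and Conjecture 11] -/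
theorem tendstoLaw_traceNC_closedDisk_supercritical (hx : criticalFugacity < x) (ha : ‖a‖ = 1)
    (hb : ‖b‖ = 1) (hab : a ≠ b)
    (hAB : ∀ δ : ℝ, 0 < δ → IsClosestSite unitDisk δ a (A δ) ∧ IsClosestSite unitDisk δ b (B δ))
    {Ω' : Type*} [MeasurableSpace Ω'] (W : Measure Ω') [IsProbabilityMeasure W] :
    TendstoLaw (fun δ (γ : DomainSAW unitDisk δ (A δ) (B δ)) => traceNC γ.curve)
      (fun δ => lawAt x unitDisk δ (A δ) (B δ))
      (fun _ : Ω' => (⟨⟨closedBall (0 : ℂ) 1, isCompact_closedBall 0 1⟩,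
        ⟨0, mem_closedBall_self zero_le_one⟩⟩ : NonemptyCompacts ℂ)) W := by
  have hx0 : 0 < x := criticalFugacity_nonneg.trans_lt hx
  refine tendstoLaw_const_of_tendsto_measure_lt_dist (P := fun δ => lawAt x unitDisk δ (A δ) (B δ))
    ?_ (fun δ f => (DomainSAW.measurable_of_top _).aestronglyMeasurable) _ (fun η hη => ?_) W
  · filter_upwards [self_mem_nhdsWithin] with δ hδ
    exact isProbabilityMeasure_lawAt hδ (hAB δ hδ).1.1 (hAB δ hδ).2.1 hx0
  · have h := tendsto_lawAt_lt_hausdorffDist_closedDisk hx ha hb hab hAB hη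
    refine h.congr' (Eventually.of_forall fun δ => ?_)
    simp only [NonemptyCompacts.dist_eq, coe_traceNC, NonemptyCompacts.coe_mk, Compacts.coe_mk]

end Supercritical

end SupercriticalSAW

open SupercriticalSAW

/-! ### The audited barrier (thirteenth audit): the topology axis -/

/-- **Barrier `SupercriticalSAWSpaceFillingHyperspace`** (thirteenth audit of the mechanism of
`SupercriticalSAWSpaceFilling`; PROVED below, `SupercriticalSAWSpaceFillingHyperspace_holds`):
Theorem 1 of Duminil-Copin–Kozma–Yadin in its HYPERSPACE form — in the unit disk with boundary
points `a ≠ b`, closest-site endpoints and any fugacity `x > x_c = 1/μ`, the TRACE of the walk,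
as a random compact set, converges in probability in the Hausdorff metric to the closed disc:
for every `r > 0`, `P_{(𝔻_δ,a_δ,b_δ,x)}[d_H(trace γ_δ, 𝔻̄) > r] → 0` as `δ → 0⁺`.

BARRIER (structured block, D-0021):
- technique_class: that of `SupercriticalSAWSpaceFilling` (fugacity-robust, `δ`-uniform conclusions about the fugacity-`x` self-avoiding walk), read along the TOPOLOGY axis: any `x`-robust (right-closed or two-sided) conclusion identifying or constraining the scaling limit of the TRACE `range γ_δ` as a RANDOM COMPACT SET — convergence in law in the hyperspace `NonemptyCompacts ℂ` (Hausdorff metric = Vietoris = Fell / myopic topology on compact sets, the topology of random-set theory and of avoidance / capacity functionals) to any random compact set with a non-trivial avoidance functional on the domain (the trace of chordal SLE_κ, `κ < 8`; conformal-restriction hulls; random sets of dimension `< 2`; any set missing a ball with positive probability), or any identification of subsequential hyperspace limits other than the point mass at `𝔻̄`; on the compact subsets of `𝔻̄` the Hausdorff metric topology coincides with the Vietoris (myopic) and Fell topologies in which laws of random closed sets are formulated [cite: Molchanov2005, App. C], so this is the widest standard topological reading of the class, and the curve-topology class of `…Proofs`/`…ProofsNarrow` is its pull-back under the continuous trace map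 (`SupercriticalSAW.tendstoLaw_traceNC_of_tendstoLaw`, `SupercriticalSAW.ae_subset_range_of_tendstoLaw'`) [cite: DuminilCopinKozmaYadin2014, Theorem 1] [cite: LawlerSchrammWerner2004SAW, §3.4.1]
- blocks: at every single `x > x_c` (hence for every right-closed or two-sided `x`-robust class): convergence in law of the traces, as random compact sets, to any `Z` missing some ball `B(z, 2r)`, `B(z, r) ⊆ 𝔻`, with positive probability (`SupercriticalSAW.not_tendstoLaw_sets_supercritical`); every hyperspace limit in law a.s. contains `𝔻̄` (`SupercriticalSAW.ae_closedDisk_subset_of_tendstoLaw_sets_supercritical`); and positively: the hyperspace scaling limit EXISTS and is the point mass at `𝔻̄` (`SupercriticalSAW.tendstoLaw_traceNC_closedDisk_supercritical`, `SupercriticalSAW.tendsto_lawAt_lt_hausdorffDist_closedDisk`), so no hyperspace-level statement distinguishes the supercritical phase from any other onto regime — the general lemmas hold for every weakly space-filling family of finite laws on any lattice model (`SupercriticalSAW.ae_subset_of_tendstoLaw_sets`, `SupercriticalSAW.ae_closure_subset_of_tendstoLaw_sets`, `SupercriticalSAW.not_tendstoLaw_sets_of_not_ae_subset`, `SupercriticalSAW.tendsto_measure_lt_hausdorffDist_of_forall_ball`,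 `SupercriticalSAW.tendstoLaw_const_of_tendsto_measure_lt_dist`) [cite: DuminilCopinKozmaYadin2014, Theorem 1]
- because: the functional `K ↦ g_r(dist(z, K))` is bounded and `1/r`-Lipschitz for the Hausdorff distance (`Metric.lipschitz_infDist_set`), equals `1` on sets missing `B(z, 2r)` and `0` on sets meeting `B(z, r)`; weak space-filling [cite: DuminilCopinKozmaYadin2014, §1 (When x > 1/μ)] kills its lattice integrals, convergence in law transports the limit, so `dist(z, Z) ≤ r` a.s. for countably many balls and `Z ⊇ 𝔻̄` (one-sided portmanteau [cite: Billingsley1999, Thm 2.1]); conversely finitely many balls `B(zᵢ, ρᵢ) ⊆ 𝔻` covering `𝔻̄` at scale `r/2` and the inclusion `trace ⊆ 𝔻̄` (convexity of the disc) give `d_H(trace, 𝔻̄) ≤ r` off a union of miss events of probability `→ 0`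
- evasions_known: those of the base entry `SupercriticalSAWSpaceFilling` and of `…ProofsNarrow` (iv)/(v), `…ProofsOnto` (vii)–(ix), `…LeftRobust` (xii), `…Reversible` (xiii), `…Density` (xiv), `…Mesoscopic` (xv) — unchanged: the topology axis adds NO refuge (weaker topologies on the trace only enlarge the obstructed class) and removes none (statistics that are not functions of the trace — prefixes / first-exit laws and driving functions on compact capacity intervals (iv), sides and windings (xiii), length and density normalisations (`…Tuned`, `…Density`), time order of visits — are untouched, as are the window (i), canonical (v), critical-manifold (vi), existential (x), tuned (xi) and left (xii) classes); recorded for planners of hyperspace routes (laws of `range γ_δ` on the compact hyperspace `{K ⊆ D̄}`, relatively compact with NO tightness estimate, identified through avoidance functionals / restriction cocycles, cf. the uniqueness theorem `Literature.MeasureTheory.RandomSets.ext_of_forall_measure_setOf_disjoint_eq`): such a route is admissible only AT `x_c` (or in the fugacity-free classes), exactly like the curve-topology routes, and its identification step must use an `x_c`-specific input (simplicity / non-trivial avoidance of the limit), since at every `x > x_c` the same compactness argument converges — to `δ_{𝔻̄}` [cite: DuminilCopinKozmaYadin2014, Theorem 1] [cite: DuminilCopinKozmaYadin2014, §4 (p.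 8, Smirnov's SLE₈ prediction for x > 1/μ)] [cite: LawlerSchrammWerner2004SAW, §3.4.1]
- scope_caveats: proved for the unit disk with closest-site endpoints of two distinct BOUNDARY points (the setting of Theorem 1, `DKY2014_thm1_holds`); the general hyperspace lemmas are for any open set of a separable metric space and any family of finite laws, the deterministic-limit lemma needs `closure Ω` compact and traces inside `closure Ω` (for the disc: convexity, `SupercriticalSAW.range_curve_subset_unitDisk`); interior endpoints (boundary-to-interior "radial" and interior-to-interior variants of the sub-problem) are covered by NO declaration of the catalogue and are not verbatim in print either — Theorems 1 and 2 of the source take "two points on its boundary" [cite: DuminilCopinKozmaYadin2014, Theorems 1–2] and the tree's Peierls estimate `SupercriticalSAW.DKY2014_thm6_disk` is organised around boundary closest sites — although the local polygon-insertion surgery of Proposition 7 is blind to the position of the endpoints [cite: DuminilCopinKozmaYadin2014, Proposition 7], so `x`-robust radial / whole-plane conclusions are dead in substance, not by a theorem; the law-level statement `tendstoLaw_traceNC_closedDisk_supercritical` is for probability laws, which `lawAt x` is for `δ > 0` and endpoints in `𝔻_δ` (`SupercriticalSAW.isProbabilityMeasure_lawAt`); nothing is asserted about hyperspace limits of the trace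 restricted to mesoscopic windows (covered by `…Mesoscopic` in the ball-avoidance form) or below `O(log(1/δ))` lattice spacings
- status: established (proved in the tree: `SupercriticalSAWSpaceFillingHyperspace_holds`, axioms `propext`, `Classical.choice`, `Quot.sound`); audit gen 13 of `…Proofs` 2026-08-16: CONFIRMED at page level [cite: DuminilCopinKozmaYadin2014, Theorem 1] [cite: DuminilCopinKozmaYadin2014, §4 (Problems 9–10)] (pp. 2, 3, 8 of arXiv:1110.3074 re-read: Theorem 1 verbatim, "two points on its boundary", "very little additional information", Problems 9–10, Smirnov's SLE₈ prediction; axiom closures of `SupercriticalSAWSpaceFilling_holds`, `SupercriticalSAW.not_robustSAWScalingLimit`, `SupercriticalSAW.sawScalingLimitAt_iff_of_pos` re-checked; forward citations since 2023: 4, newest Ann. Probab. 54 (2026) [cite: KrachunPanagiotis2026], none evading; zbMATH "self-avoiding walk" 2025–2026, 38 items — connective-constant bounds, ballisticity on graphs with more than one end, high-dimensional crossover, `c = 0` logarithmic CFT — none on supercritical planar scaling limits or on Problem 10; the hub's local index, OpenAlex and Semantic Scholar were unavailable or rate-limited during the audit, arXiv / zbMATH / Crossref / the internal galaxy corpora were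 used) and STRENGTHENED on the topology axis (the `d_H` clause of `…ProofsNarrow`'s technique class, previously prose, is now a theorem, together with the existence and triviality of the hyperspace limit)

[cite: DuminilCopinKozmaYadin2014, Theorem 1] -/
def SupercriticalSAWSpaceFillingHyperspace : Prop :=
  ∀ a b : ℂ, ‖a‖ = 1 → ‖b‖ = 1 → a ≠ b →
    ∀ x : ℝ, criticalFugacity < x →
      ∀ A B : ℝ → Site 2,
        (∀ δ : ℝ, 0 < δ → IsClosestSite unitDisk δ a (A δ) ∧ IsClosestSite unitDisk δ b (B δ)) →
          ∀ r : ℝ, 0 < r →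
            Tendsto (fun δ : ℝ => lawAt x unitDisk δ (A δ) (B δ)
                {γ | r < hausdorffDist γ.curve.range (closedBall (0 : ℂ) 1)})
              (𝓝[>] 0) (𝓝 0)

/-- **The audited barrier holds** (`tendsto_lawAt_lt_hausdorffDist_closedDisk`, from Theorem 1 as
proved in the tree, `DKY2014_thm1_holds`). [cite: DuminilCopinKozmaYadin2014, Theorem 1] -/
theorem SupercriticalSAWSpaceFillingHyperspace_holds : SupercriticalSAWSpaceFillingHyperspace :=
  fun _ _ ha hb hab _ hx _ _ hAB _ hr => tendsto_lawAt_lt_hausdorffDist_closedDisk hx ha hb hab hAB hr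

/-- The hyperspace barrier contains the macroscopic one: Hausdorff convergence in probability to
`𝔻̄` gives back the weak space-filling of §1 for every supercritical fugacity in the disc
(`isSpaceFillingFamily_of_tendsto_hausdorffDist`) — the two are equivalent at the lattice level.
[cite: DuminilCopinKozmaYadin2014, §1 (When x > 1/μ) and Theorem 1] -/
theorem SupercriticalSAWSpaceFillingHyperspace.isSpaceFillingFamily
    (h : SupercriticalSAWSpaceFillingHyperspace) {a b : ℂ} (ha : ‖a‖ = 1) (hb : ‖b‖ = 1)
    (hab : a ≠ b) {x : ℝ} (hx : criticalFugacity < x) {A B : ℝ → Site 2}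
    (hAB : ∀ δ : ℝ, 0 < δ → IsClosestSite unitDisk δ a (A δ) ∧ IsClosestSite unitDisk δ b (B δ)) :
    IsSpaceFillingFamily x unitDisk A B :=
  isSpaceFillingFamily_of_tendsto_hausdorffDist fun r hr => h a b ha hb hab x hx A B hAB r hr

end Literature.Barriers.CriticalPhenomena
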